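import Mathlib
import Summits.AtomisticToContinuum.HydrodynamicLimit.Theorems.ImplosionDichotomyDenseExcursionSonicSlavingGauge
import Summits.AtomisticToContinuum.HydrodynamicLimit.Theorems.ImplosionDichotomyDenseExcursionSonicConfinementContinuation

/-!
# Local uniqueness of the smooth branch at the repulsive sonic point
# (crux `DenseExcursion`, line `sonic-cavity-renewal` v6, brick (M3b) for the registered helper `sonicSlaving_of_tube`)

Helper file (`--supports stmt-AtomisticToContinuum-12586`, line lead a2, stub-worker W2 for `sonicSlaving_of_tube`).
The sonic point `x = 0` of a tube profile (`W 0 + S 0 = 1`, chord bound `|W + S − 1| ≥ 3|x|/8`) is a regular singular point of the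
mode system with exponents `{0, ν(Λ)}`, `ν = (b₊₊(0) − Λ)/κ`. For `Im Λ ≠ 0` the recursion for the Taylor jet of a `C^∞` solution at `0`
is NON-RESONANT (pivots `κ(n − ν)`, `Im ν = −Im Λ/κ ≠ 0`; `c₋(0) = −2S(0) ≠ 0`), so the jet is determined by `m(0) = ŵ 0 − 3ŝ 0`; a `C^∞`
solution with `m(0) = 0` is FLAT at `0`, and the singular Grönwall lemma (`…SonicConfinementFlat`) on both sides of `0` kills it:
* `fuchsian_jets_eq_zero` (generic): `C^∞` functions on an open set `∋ 0` with `c₊ p′ = A p + B m`, `c₋ m′ = C p + D m`, `c₊(0) = 0`,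
  `c₋(0) ≠ 0`, `n c₊′(0) ≠ A(0)` (`n : ℕ`), `m(0) = 0` have all derivatives of `p`, `m` equal to `0` at `0` (Leibniz, strong induction);
* `norm_le_pow_of_jets_eq_zero` (local Taylor bound) and `eq_zero_of_jets_eq_zero_of_singular_bound` (flat at `0` +
  `‖v′‖ ≤ (C/|x|)‖v‖` on `0 < |x| ≤ b` ⟹ `v ≡ 0` on `[−b, b]`; the left side by reflection);
* `smoothBranch_eq_zero_near_sonic` (registered helper): a `C^∞` solution of the mode equations on `(−δ, δ)`, `δ ≤ 1`, of a monatomic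
  tube profile, with `Im Λ ≠ 0` and `ŵ 0 = 3 ŝ 0`, vanishes on `(−δ, δ)`. By linearity two `C^∞` solutions near the sonic point with the
  same `m(0)` coincide — a smooth radial mode coincides near `0` with the analytic Frobenius branch through `(ρ(0) m(0), m(0))` as soon
  as that branch exists (identification step (M3) of `work/stubs/W2_sonicSlaving.REPORT.md`); the smooth branch is one-dimensional.
Sources: Coddington–Levinson 1955 Ch. 4 §§1–3; Chen–Shkoller–Vicol arXiv:2605.00808 §1.10. No citation is load-bearing.
-/

noncomputable section

open Set Filter
open scoped Topology ContDiff

namespace Summit.AtomisticToContinuum.HydrodynamicLimit.Theorems.SonicCavityRenewal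

open Summit.AtomisticToContinuum.HydrodynamicLimit.Theorems.R2OneModeTwoConditions

/-! ## The non-resonant jet recursion at a singularity of the first kind -/

/-- **NON-RESONANT JETS VANISH.** Let `p, m, c₊, c₋, A, B, C, D : ℝ → ℂ` be `C^∞` on an open set `s ∋ 0` with
`c₊ p′ = A p + B m` and `c₋ m′ = C p + D m` on `s`, `c₊(0) = 0`, `c₋(0) ≠ 0`, and the non-resonance condition `n·c₊′(0) ≠ A(0)` for
every `n : ℕ`. If `m(0) = 0` then ALL derivatives of `p` and `m` vanish at `0`: differentiating the second equation `n` times at `0`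
gives `c₋(0) m⁽ⁿ⁺¹⁾(0) = (lower jets) = 0`, and the first `n + 1` times gives `((n+1) c₊′(0) − A(0)) p⁽ⁿ⁺¹⁾(0) = (lower jets) = 0`.
[folklore] -/
theorem fuchsian_jets_eq_zero {s : Set ℝ} (hs : IsOpen s) (h0s : (0 : ℝ) ∈ s) {p m cp cm A B C D : ℝ → ℂ}
    (hp : ContDiffOn ℝ ∞ p s) (hm : ContDiffOn ℝ ∞ m s) (hcp : ContDiffOn ℝ ∞ cp s) (hcm : ContDiffOn ℝ ∞ cm s)
    (hA : ContDiffOn ℝ ∞ A s) (hB : ContDiffOn ℝ ∞ B s) (hC : ContDiffOn ℝ ∞ C s) (hD : ContDiffOn ℝ ∞ D s)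
    (h1 : ∀ x ∈ s, cp x * deriv p x = A x * p x + B x * m x) (h2 : ∀ x ∈ s, cm x * deriv m x = C x * p x + D x * m x)
    (hcp0 : cp 0 = 0) (hcm0 : cm 0 ≠ 0) (hres : ∀ n : ℕ, (n : ℂ) * deriv cp 0 ≠ A 0) (hm0 : m 0 = 0) :
    ∀ n : ℕ, iteratedDeriv n p 0 = 0 ∧ iteratedDeriv n m 0 = 0 := by
  -- smoothness at `0`, every finite order
  have h0 : s ∈ 𝓝 (0 : ℝ) := hs.mem_nhds h0s
  have hAt : ∀ {f : ℝ → ℂ}, ContDiffOn ℝ ∞ f s → ∀ k : ℕ, ContDiffAt ℝ k f 0 := fun hf k =>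
    (hf.contDiffAt h0).of_le (by exact_mod_cast le_top)
  have hdp : ContDiffOn ℝ ∞ (deriv p) s := ((contDiffOn_infty_iff_deriv_of_isOpen hs).1 hp).2
  have hdm : ContDiffOn ℝ ∞ (deriv m) s := ((contDiffOn_infty_iff_deriv_of_isOpen hs).1 hm).2
  have e1 : (fun x => cp x * deriv p x) =ᶠ[𝓝 0] fun x => A x * p x + B x * m x := eventually_of_mem h0 h1
  have e2 : (fun x => cm x * deriv m x) =ᶠ[𝓝 0] fun x => C x * p x + D x * m x := eventually_of_mem h0 h2
  -- Leibniz expansions of both equations at every order `N`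
  have L1 : ∀ N : ℕ, ∑ i ∈ Finset.range (N + 1), (N.choose i : ℂ) * iteratedDeriv i cp 0 * iteratedDeriv (N - i + 1) p 0 =
      ∑ i ∈ Finset.range (N + 1), (N.choose i : ℂ) * iteratedDeriv i A 0 * iteratedDeriv (N - i) p 0 +
        ∑ i ∈ Finset.range (N + 1), (N.choose i : ℂ) * iteratedDeriv i B 0 * iteratedDeriv (N - i) m 0 := by
    intro N
    have h := e1.iteratedDeriv_eq N
    rw [iteratedDeriv_fun_mul (hAt hcp N) (hAt hdp N),
      iteratedDeriv_fun_add ((hAt hA N).mul (hAt hp N)) ((hAt hB N).mul (hAt hm N)),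
      iteratedDeriv_fun_mul (hAt hA N) (hAt hp N), iteratedDeriv_fun_mul (hAt hB N) (hAt hm N)] at h
    simpa only [← iteratedDeriv_succ'] using h
  have L2 : ∀ N : ℕ, ∑ i ∈ Finset.range (N + 1), (N.choose i : ℂ) * iteratedDeriv i cm 0 * iteratedDeriv (N - i + 1) m 0 =
      ∑ i ∈ Finset.range (N + 1), (N.choose i : ℂ) * iteratedDeriv i C 0 * iteratedDeriv (N - i) p 0 +
        ∑ i ∈ Finset.range (N + 1), (N.choose i : ℂ) * iteratedDeriv i D 0 * iteratedDeriv (N - i) m 0 := by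
    intro N
    have h := e2.iteratedDeriv_eq N
    rw [iteratedDeriv_fun_mul (hAt hcm N) (hAt hdm N),
      iteratedDeriv_fun_add ((hAt hC N).mul (hAt hp N)) ((hAt hD N).mul (hAt hm N)),
      iteratedDeriv_fun_mul (hAt hC N) (hAt hp N), iteratedDeriv_fun_mul (hAt hD N) (hAt hm N)] at h
    simpa only [← iteratedDeriv_succ'] using h
  -- strong induction on the order
  suffices H : ∀ n : ℕ, ∀ k, k ≤ n → iteratedDeriv k p 0 = 0 ∧ iteratedDeriv k m 0 = 0 from fun n => H n n le_rfl
  intro n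
  induction n with
  | zero =>
    intro k hk
    obtain rfl : k = 0 := Nat.le_zero.1 hk
    have hA0 : A 0 ≠ 0 := fun hA0 => hres 0 (by rw [Nat.cast_zero, zero_mul, hA0])
    have hpt := h1 0 h0s
    rw [hcp0, zero_mul, hm0, mul_zero, add_zero] at hpt
    refine ⟨?_, by simpa using hm0⟩
    rw [iteratedDeriv_zero]
    exact (mul_eq_zero.1 hpt.symm).resolve_left hA0
  | succ n ih =>
    intro k hk
    rcases Nat.le_succ_iff.1 hk with hk' | rfl
    · exact ih k hk'
    -- order `n + 1` for `m`
    have hmn : iteratedDeriv (n + 1) m 0 = 0 := by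
      have h := L2 n
      have hl : ∑ i ∈ Finset.range (n + 1), (n.choose i : ℂ) * iteratedDeriv i cm 0 * iteratedDeriv (n - i + 1) m 0 =
          cm 0 * iteratedDeriv (n + 1) m 0 := by
        rw [Finset.sum_eq_single 0]
        · simp
        · intro i hi hi0
          have hi' := Finset.mem_range.1 hi
          rw [(ih (n - i + 1) (by omega)).2, mul_zero]
        · exact fun h' => absurd (Finset.mem_range.2 (Nat.succ_pos n)) h'
      have hr1 : ∑ i ∈ Finset.range (n + 1), (n.choose i : ℂ) * iteratedDeriv i C 0 * iteratedDeriv (n - i) p 0 = 0 :=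
        Finset.sum_eq_zero fun i _ => by rw [(ih (n - i) (Nat.sub_le n i)).1, mul_zero]
      have hr2 : ∑ i ∈ Finset.range (n + 1), (n.choose i : ℂ) * iteratedDeriv i D 0 * iteratedDeriv (n - i) m 0 = 0 :=
        Finset.sum_eq_zero fun i _ => by rw [(ih (n - i) (Nat.sub_le n i)).2, mul_zero]
      rw [hl, hr1, hr2, add_zero] at h
      exact (mul_eq_zero.1 h).resolve_left hcm0
    -- order `n + 1` for `p`
    have hpn : iteratedDeriv (n + 1) p 0 = 0 := by
      have h := L1 (n + 1)
      have hl : ∑ i ∈ Finset.range (n + 1 + 1),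
            ((n + 1).choose i : ℂ) * iteratedDeriv i cp 0 * iteratedDeriv (n + 1 - i + 1) p 0 =
          ((n + 1 : ℕ) : ℂ) * deriv cp 0 * iteratedDeriv (n + 1) p 0 := by
        rw [Finset.sum_eq_single 1]
        · rw [Nat.choose_one_right, iteratedDeriv_one, Nat.add_sub_cancel]
        · intro i hi hi1
          have hi' := Finset.mem_range.1 hi
          rcases Nat.lt_or_ge i 1 with hlt | hge
          · obtain rfl : i = 0 := Nat.lt_one_iff.1 hlt
            rw [iteratedDeriv_zero, hcp0, mul_zero, zero_mul]
          · rw [(ih (n + 1 - i + 1) (by omega)).1, mul_zero]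
        · exact fun h' => absurd (Finset.mem_range.2 (by omega)) h'
      have hr1 : ∑ i ∈ Finset.range (n + 1 + 1),
            ((n + 1).choose i : ℂ) * iteratedDeriv i A 0 * iteratedDeriv (n + 1 - i) p 0 = A 0 * iteratedDeriv (n + 1) p 0 := by
        rw [Finset.sum_eq_single 0]
        · simp
        · intro i hi hi0
          have hi' := Finset.mem_range.1 hi
          rw [(ih (n + 1 - i) (by omega)).1, mul_zero]
        · exact fun h' => absurd (Finset.mem_range.2 (by omega)) h'
      have hr2 : ∑ i ∈ Finset.range (n + 1 + 1),
            ((n + 1).choose i : ℂ) * iteratedDeriv i B 0 * iteratedDeriv (n + 1 - i) m 0 = 0 := by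
        refine Finset.sum_eq_zero fun i hi => ?_
        have hi' := Finset.mem_range.1 hi
        rcases Nat.eq_zero_or_pos i with rfl | hpos
        · rw [Nat.sub_zero, hmn, mul_zero]
        · rw [(ih (n + 1 - i) (by omega)).2, mul_zero]
      rw [hl, hr1, hr2, add_zero] at h
      have h' : (((n + 1 : ℕ) : ℂ) * deriv cp 0 - A 0) * iteratedDeriv (n + 1) p 0 = 0 := by
        linear_combination h
      exact (mul_eq_zero.1 h').resolve_left (sub_ne_zero.2 (hres (n + 1)))
    exact ⟨hpn, hmn⟩

/-! ## Flat solutions of a system with a first-kind singular bound vanish (both sides of `0`) -/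

-- adapted from `norm_le_pow_of_iteratedDeriv_eq_zero` (…SonicConfinementFlat), localised to `ContDiffOn` on an open set
/-- LOCAL TAYLOR BOUND: a function `C^∞` on an open set `s ⊇ [0, b]` whose derivatives of order `≤ n` vanish at `0` satisfies
`‖f x‖ ≤ M x^{n+1}` on `[0, b]`. [folklore] -/
theorem norm_le_pow_of_jets_eq_zero {f : ℝ → ℂ} {n : ℕ} {b : ℝ} {s : Set ℝ} (hb : 0 < b) (hs : IsOpen s)
    (hsub : Icc 0 b ⊆ s) (hf : ContDiffOn ℝ ∞ f s) (h0 : ∀ k, k ≤ n → iteratedDeriv k f 0 = 0) :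
    ∃ M : ℝ, ∀ x ∈ Icc 0 b, ‖f x‖ ≤ M * x ^ (n + 1) := by
  have hf' : ContDiffOn ℝ (n + 1) f (Icc 0 b) := (hf.of_le (by exact_mod_cast le_top)).mono hsub
  have hu : UniqueDiffOn ℝ (Icc 0 b) := uniqueDiffOn_Icc hb
  have hcont : ContinuousOn (fun y => iteratedDerivWithin (n + 1) f (Icc 0 b) y) (Icc 0 b) :=
    hf'.continuousOn_iteratedDerivWithin le_rfl hu
  obtain ⟨C, hC⟩ := isCompact_Icc.exists_bound_of_continuousOn hcont
  have h0s : s ∈ 𝓝 (0 : ℝ) := hs.mem_nhds (hsub (left_mem_Icc.2 hb.le))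
  refine ⟨C / n.factorial, fun x hx => ?_⟩
  have hT : taylorWithinEval f n (Icc 0 b) 0 x = 0 := by
    rw [taylor_within_apply]
    refine Finset.sum_eq_zero fun k hk => ?_
    have hk' : k ≤ n := Nat.lt_succ_iff.1 (Finset.mem_range.1 hk)
    rw [iteratedDerivWithin_eq_iteratedDeriv hu ((hf.contDiffAt h0s).of_le (by exact_mod_cast le_top))
      (left_mem_Icc.2 hb.le), h0 k hk', smul_zero]
  have h := taylor_mean_remainder_bound hb.le hf' hx hC
  rw [hT, sub_zero, sub_zero] at h
  calc ‖f x‖ ≤ C * x ^ (n + 1) / n.factorial := h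
    _ = C / n.factorial * x ^ (n + 1) := by ring

/-- ONE-SIDED VANISHING: `p, m` `C^∞` on an open `s ⊇ [0, b]` (`b ≤ 1`), flat at `0`, with the first-kind singular bound
`‖(p′, m′)(x)‖ ≤ (C/x)‖(p, m)(x)‖` on `(0, b]`, vanish on `(0, b]` (Taylor to order `⌈C⌉ + 1`, then `eq_zero_of_flat_of_norm_deriv_le`).
[folklore] -/
theorem eq_zero_Ioc_of_jets_eq_zero {p m : ℝ → ℂ} {b C : ℝ} {s : Set ℝ} (hb : 0 < b) (hb1 : b ≤ 1) (hC : 0 ≤ C)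
    (hs : IsOpen s) (hsub : Icc 0 b ⊆ s) (hp : ContDiffOn ℝ ∞ p s) (hm : ContDiffOn ℝ ∞ m s)
    (hjet : ∀ n : ℕ, iteratedDeriv n p 0 = 0 ∧ iteratedDeriv n m 0 = 0)
    (hbound : ∀ x ∈ Ioc 0 b, ‖(deriv p x, deriv m x)‖ ≤ C / x * ‖(p x, m x)‖) :
    ∀ x ∈ Ioc 0 b, p x = 0 ∧ m x = 0 := by
  set N : ℕ := ⌈C⌉₊ + 1 with hN
  obtain ⟨M₁, hM₁⟩ := norm_le_pow_of_jets_eq_zero (n := ⌈C⌉₊) hb hs hsub hp fun k _ => (hjet k).1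
  obtain ⟨M₂, hM₂⟩ := norm_le_pow_of_jets_eq_zero (n := ⌈C⌉₊) hb hs hsub hm fun k _ => (hjet k).2
  have hpd : ∀ x ∈ s, HasDerivAt p (deriv p x) x := fun x hx =>
    ((hp.differentiableOn (by simp)).differentiableAt (hs.mem_nhds hx)).hasDerivAt
  have hmd : ∀ x ∈ s, HasDerivAt m (deriv m x) x := fun x hx =>
    ((hm.differentiableOn (by simp)).differentiableAt (hs.mem_nhds hx)).hasDerivAt
  set v : ℝ → ℂ × ℂ := fun x => (p x, m x) with hv
  set v' : ℝ → ℂ × ℂ := fun x => (deriv p x, deriv m x) with hv'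
  have hvd : ∀ x ∈ Ioc 0 b, HasDerivAt v (v' x) x := fun x hx =>
    (hpd x (hsub ⟨hx.1.le, hx.2⟩)).prodMk (hmd x (hsub ⟨hx.1.le, hx.2⟩))
  have hflat : ∀ x ∈ Ioc 0 b, ‖v x‖ ≤ (|M₁| + |M₂|) * x ^ N := by
    intro x hx
    have hx' : x ∈ Icc 0 b := ⟨hx.1.le, hx.2⟩
    have hxN : 0 ≤ x ^ N := pow_nonneg hx.1.le N
    have h1 : ‖p x‖ ≤ |M₁| * x ^ N := (hM₁ x hx').trans (mul_le_mul_of_nonneg_right (le_abs_self _) hxN)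
    have h2 : ‖m x‖ ≤ |M₂| * x ^ N := (hM₂ x hx').trans (mul_le_mul_of_nonneg_right (le_abs_self _) hxN)
    change ‖(p x, m x)‖ ≤ _
    rw [Prod.norm_mk, max_le_iff]
    have : 0 ≤ |M₁| * x ^ N := by positivity
    have : 0 ≤ |M₂| * x ^ N := by positivity
    constructor <;> nlinarith
  have hCN : C + 1 ≤ (N : ℝ) := by
    rw [hN]
    push_cast
    linarith [Nat.le_ceil C]
  have hzero := eq_zero_of_flat_of_norm_deriv_le v v' b C (|M₁| + |M₂|) N hb hb1 hC hvd hbound hflat hCN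
  intro x hx
  have hvx := hzero x hx
  exact ⟨congrArg Prod.fst hvx, congrArg Prod.snd hvx⟩

/-- TWO-SIDED VANISHING: `p, m` `C^∞` on an open `s ⊇ [−b, b]` (`b ≤ 1`), flat at `0`, with `‖(p′, m′)(x)‖ ≤ (C/|x|)‖(p, m)(x)‖` for
`0 < |x| ≤ b`, vanish on `[−b, b]` (the left side by the reflection `x ↦ −x`, `iteratedDeriv_comp_neg`). [folklore] -/
theorem eq_zero_of_jets_eq_zero_of_singular_bound {p m : ℝ → ℂ} {b C : ℝ} {s : Set ℝ} (hb : 0 < b) (hb1 : b ≤ 1)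
    (hC : 0 ≤ C) (hs : IsOpen s) (hsub : Icc (-b) b ⊆ s) (hp : ContDiffOn ℝ ∞ p s) (hm : ContDiffOn ℝ ∞ m s)
    (hjet : ∀ n : ℕ, iteratedDeriv n p 0 = 0 ∧ iteratedDeriv n m 0 = 0)
    (hbound : ∀ x ∈ s, 0 < |x| → |x| ≤ b → ‖(deriv p x, deriv m x)‖ ≤ C / |x| * ‖(p x, m x)‖) :
    ∀ x ∈ Icc (-b) b, p x = 0 ∧ m x = 0 := by
  have hsub' : Icc 0 b ⊆ s := (Icc_subset_Icc (by linarith) le_rfl).trans hsub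
  -- right side
  have hright : ∀ x ∈ Ioc 0 b, p x = 0 ∧ m x = 0 := by
    refine eq_zero_Ioc_of_jets_eq_zero hb hb1 hC hs hsub' hp hm hjet fun x hx => ?_
    have h := hbound x (hsub' ⟨hx.1.le, hx.2⟩) (abs_pos.2 hx.1.ne') (by rw [abs_of_pos hx.1]; exact hx.2)
    rwa [abs_of_pos hx.1] at h
  -- left side, by reflection
  have hleft : ∀ x ∈ Ioc 0 b, p (-x) = 0 ∧ m (-x) = 0 := by
    set s' : Set ℝ := Neg.neg ⁻¹' s with hs'
    have hs'o : IsOpen s' := hs.preimage continuous_neg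
    have hsub'' : Icc 0 b ⊆ s' := fun x hx => hsub ⟨by linarith [hx.2], by linarith [hx.1]⟩
    have hpn : ContDiffOn ℝ ∞ (fun x => p (-x)) s' := hp.comp contDiff_neg.contDiffOn fun x hx => hx
    have hmn : ContDiffOn ℝ ∞ (fun x => m (-x)) s' := hm.comp contDiff_neg.contDiffOn fun x hx => hx
    have hjet' : ∀ n : ℕ, iteratedDeriv n (fun x => p (-x)) 0 = 0 ∧ iteratedDeriv n (fun x => m (-x)) 0 = 0 := fun n => by
      simp only [iteratedDeriv_comp_neg, neg_zero, (hjet n).1, (hjet n).2, smul_zero, and_self]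
    have hdp : ∀ x ∈ s', deriv (fun y => p (-y)) x = -deriv p (-x) := fun x hx => by
      have hd : HasDerivAt p (deriv p (-x)) (-x) :=
        ((hp.differentiableOn (by simp)).differentiableAt (hs.mem_nhds hx)).hasDerivAt
      have hd' : HasDerivAt (fun y => p (-y)) ((-1 : ℝ) • deriv p (-x)) x := hd.scomp x (hasDerivAt_neg x)
      rw [hd'.deriv, neg_one_smul]
    have hdm : ∀ x ∈ s', deriv (fun y => m (-y)) x = -deriv m (-x) := fun x hx => by
      have hd : HasDerivAt m (deriv m (-x)) (-x) :=
        ((hm.differentiableOn (by simp)).differentiableAt (hs.mem_nhds hx)).hasDerivAt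
      have hd' : HasDerivAt (fun y => m (-y)) ((-1 : ℝ) • deriv m (-x)) x := hd.scomp x (hasDerivAt_neg x)
      rw [hd'.deriv, neg_one_smul]
    refine eq_zero_Ioc_of_jets_eq_zero hb hb1 hC hs'o hsub'' hpn hmn hjet' fun x hx => ?_
    have hxs : x ∈ s' := hsub'' ⟨hx.1.le, hx.2⟩
    rw [hdp x hxs, hdm x hxs]
    have h := hbound (-x) hxs (by rw [abs_neg]; exact abs_pos.2 hx.1.ne') (by rw [abs_neg, abs_of_pos hx.1]; exact hx.2)
    rw [abs_neg, abs_of_pos hx.1] at h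
    calc ‖(-deriv p (-x), -deriv m (-x))‖ = ‖(deriv p (-x), deriv m (-x))‖ := by
          rw [← Prod.neg_mk, norm_neg]
      _ ≤ C / x * ‖(p (-x), m (-x))‖ := h
  -- the point `0` and assembly
  intro x hx
  rcases lt_trichotomy x 0 with h | h | h
  · have := hleft (-x) ⟨by linarith, by linarith [hx.1]⟩
    simpa using this
  · subst h
    simpa only [iteratedDeriv_zero] using hjet 0
  · exact hright x ⟨h, hx.2⟩

/-! ## The smooth branch of the mode system at the sonic point is determined by `m(0)` -/

/-- Real-analytic-style smoothness of the profile coefficients: for a `C^∞` real function `g`, `x ↦ (g x : ℂ)` is `C^∞`. [folklore] -/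
theorem contDiff_ofReal_comp {g : ℝ → ℝ} (hg : ContDiff ℝ ∞ g) : ContDiff ℝ ∞ fun x => ((g x : ℝ) : ℂ) :=
  Complex.ofRealCLM.contDiff.comp hg

/-- **LOCAL UNIQUENESS OF THE SMOOTH BRANCH AT THE SONIC POINT** — registered helper `smoothBranch_eq_zero_near_sonic` for
`sonicSlaving_of_tube`. For a monatomic profile in the cavity tube and `Im Λ ≠ 0`, a pair `(ŵ, ŝ)` that is `C^∞` on `(−δ, δ)`, `δ ≤ 1`,
solves the mode equations `Λŵ = linW`, `Λŝ = linS` there, and has `ŵ 0 − 3ŝ 0 = 0`, vanishes on `(−δ, δ)`: the jets at `0` vanish by the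
non-resonant recursion (`fuchsian_jets_eq_zero` with `c₊ = W − 1 + S`, `c₊(0) = 0`, `c₊′(0) = −κ` real, `A(0) = Λ − b₊₊(0)` of imaginary
part `Im Λ ≠ 0`; `c₋(0) = −2S(0) ≠ 0`), and a flat solution vanishes by the singular Grönwall lemma on both sides (chord bound
`|c₊| ≥ 3|x|/8`, `|c₋| ≥ 3/4`, `char_deriv_norm_le`). Hence the `C^∞` solutions near the sonic point form a space of dimension `≤ 1`,
parametrised by `m(0)`. [folklore] -/
theorem smoothBranch_eq_zero_near_sonic : ∀ (r : ℝ) (W S : ℝ → ℝ) (Λ : ℂ) (ŵ ŝ : ℝ → ℂ) (δ : ℝ), IsMonatomicProfile r W S → CavityTube r W S → Λ.im ≠ 0 → 0 < δ → δ ≤ 1 → ContDiffOn ℝ ∞ ŵ (Set.Ioo (-δ) δ) → ContDiffOn ℝ ∞ ŝ (Set.Ioo (-δ) δ) → (∀ x ∈ Set.Ioo (-δ) δ, Λ * ŵ x = linW r W S ŵ ŝ x ∧ Λ * ŝ x = linS r W S ŵ ŝ x) → ŵ 0 - 3 * ŝ 0 = 0 → ∀ x ∈ Set.Ioo (-δ)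 δ, ŵ x = 0 ∧ ŝ x = 0 := by
  intro r W S Λ ŵ ŝ δ hP hT hΛ hδ hδ1 hŵ hŝ hsol hm0
  obtain ⟨-, -, hW, hS, hSpos, -⟩ := hP
  obtain ⟨h00, -, -, hchord, -, -, -, hcW, -⟩ := hT
  set I : Set ℝ := Ioo (-δ) δ with hI
  have hIo : IsOpen I := isOpen_Ioo
  have h0I : (0 : ℝ) ∈ I := ⟨by linarith, hδ⟩
  have hW1 : Differentiable ℝ W := hW.differentiable (by simp)
  have hS1 : Differentiable ℝ S := hS.differentiable (by simp)
  have hdW : ContDiff ℝ ∞ (deriv W) := (contDiff_infty_iff_deriv.1 hW).2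
  have hdS : ContDiff ℝ ∞ (deriv S) := (contDiff_infty_iff_deriv.1 hS).2
  have hŵd : ∀ x ∈ I, DifferentiableAt ℝ ŵ x := fun x hx =>
    (hŵ.differentiableOn (by simp)).differentiableAt (hIo.mem_nhds hx)
  have hŝd : ∀ x ∈ I, DifferentiableAt ℝ ŝ x := fun x hx =>
    (hŝ.differentiableOn (by simp)).differentiableAt (hIo.mem_nhds hx)
  -- the characteristic components and the coefficient functions
  set p : ℝ → ℂ := fun x => ŵ x + 3 * ŝ x with hp
  set m : ℝ → ℂ := fun x => ŵ x - 3 * ŝ x with hm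
  set cp : ℝ → ℂ := fun x => ((W x - 1 + S x : ℝ) : ℂ) with hcp
  set cm : ℝ → ℂ := fun x => ((W x - 1 - S x : ℝ) : ℂ) with hcm
  set A : ℝ → ℂ := fun x => Λ - ((2 / 3 * deriv W x + 2 * W x - r + 2 * deriv S x + 4 * S x : ℝ) : ℂ) with hA
  set B : ℝ → ℂ := fun x => -((deriv W x / 3 + deriv S x + 2 * S x : ℝ) : ℂ) with hB
  set C : ℝ → ℂ := fun x => -((deriv W x / 3 - deriv S x - 2 * S x : ℝ) : ℂ) with hC
  set D : ℝ → ℂ := fun x => Λ - ((2 / 3 * deriv W x + 2 * W x - r - 2 * deriv S x - 4 * S x : ℝ) : ℂ) with hD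
  have hpC : ContDiffOn ℝ ∞ p I := hŵ.add (contDiffOn_const.mul hŝ)
  have hmC : ContDiffOn ℝ ∞ m I := hŵ.sub (contDiffOn_const.mul hŝ)
  have hcpC : ContDiffOn ℝ ∞ cp I := (contDiff_ofReal_comp ((hW.sub contDiff_const).add hS)).contDiffOn
  have hcmC : ContDiffOn ℝ ∞ cm I := (contDiff_ofReal_comp ((hW.sub contDiff_const).sub hS)).contDiffOn
  have hAC : ContDiffOn ℝ ∞ A I := (contDiff_const.sub (contDiff_ofReal_comp (by fun_prop))).contDiffOn
  have hBC : ContDiffOn ℝ ∞ B I := (contDiff_ofReal_comp (by fun_prop)).neg.contDiffOn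
  have hCC : ContDiffOn ℝ ∞ C I := (contDiff_ofReal_comp (by fun_prop)).neg.contDiffOn
  have hDC : ContDiffOn ℝ ∞ D I := (contDiff_const.sub (contDiff_ofReal_comp (by fun_prop))).contDiffOn
  -- the derivatives of `p`, `m`
  have hdp : ∀ x ∈ I, deriv p x = deriv ŵ x + 3 * deriv ŝ x := fun x hx =>
    (hasDerivAt_char_components (hŵd x hx) (hŝd x hx)).1.deriv
  have hdm : ∀ x ∈ I, deriv m x = deriv ŵ x - 3 * deriv ŝ x := fun x hx =>
    (hasDerivAt_char_components (hŵd x hx) (hŝd x hx)).2.deriv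
  -- the characteristic system on `I`
  have h1 : ∀ x ∈ I, cp x * deriv p x = A x * p x + B x * m x := by
    intro x hx
    rw [hdp x hx]
    have := (mode_char_system (hsol x hx)).1
    simp only [hcp, hA, hB, hp, hm]
    linear_combination this
  have h2 : ∀ x ∈ I, cm x * deriv m x = C x * p x + D x * m x := by
    intro x hx
    rw [hdm x hx]
    have := (mode_char_system (hsol x hx)).2
    simp only [hcm, hC, hD, hp, hm]
    linear_combination this
  -- data at the sonic point
  have hcp0 : cp 0 = 0 := by
    simp only [hcp]
    rw [show W 0 - 1 + S 0 = 0 by linarith, Complex.ofReal_zero]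
  have hcm0 : cm 0 ≠ 0 := by
    simp only [hcm]
    have h1 := (abs_le.1 (hcW 0 (by norm_num)).1).2
    have h2 := hSpos 0
    exact Complex.ofReal_ne_zero.2 (by linarith)
  have hdcp : deriv cp 0 = ((deriv W 0 + deriv S 0 : ℝ) : ℂ) := by
    have h : HasDerivAt (fun x => W x - 1 + S x) (deriv W 0 + deriv S 0) 0 :=
      ((hW1 0).hasDerivAt.sub_const 1).add (hS1 0).hasDerivAt
    exact h.ofReal_comp.deriv
  have hres : ∀ n : ℕ, (n : ℂ) * deriv cp 0 ≠ A 0 := by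
    intro n h
    have := congrArg Complex.im h
    rw [hdcp] at this
    simp only [hA, Complex.mul_im, Complex.natCast_re, Complex.natCast_im, Complex.ofReal_re, Complex.ofReal_im,
      mul_zero, zero_mul, add_zero, Complex.sub_im, sub_zero] at this
    exact hΛ this.symm
  have hm00 : m 0 = 0 := hm0
  -- all jets vanish
  have hjet := fuchsian_jets_eq_zero hIo h0I hpC hmC hcpC hcmC hAC hBC hCC hDC h1 h2 hcp0 hcm0 hres hm00
  -- the singular bound `‖(p′, m′)‖ ≤ (K₀/|x|) ‖(p, m)‖` on `0 < |x| < δ`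
  obtain ⟨K, hKc, hKx⟩ := charCoeffSum_continuous r hW hS Λ
  obtain ⟨B₀, hB₀⟩ := isCompact_Icc.exists_bound_of_continuousOn (hKc.continuousOn (s := Icc (-1 : ℝ) 1))
  have hB₀0 : 0 ≤ B₀ := le_trans (norm_nonneg _) (hB₀ 0 ⟨by norm_num, by norm_num⟩)
  have hbound : ∀ x ∈ I, 0 < |x| → |x| ≤ 1 → ‖(deriv p x, deriv m x)‖ ≤ 4 * B₀ / |x| * ‖(p x, m x)‖ := by
    intro x hx hx0 hx1
    have hxle : x ≤ 1 := (le_abs_self x).trans hx1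
    have hcpx : 3 / 8 * |x| ≤ |W x - 1 + S x| := by
      have h := hchord x hxle
      rwa [min_eq_left hx1, show W x + S x - 1 = W x - 1 + S x by ring] at h
    have hcmx : 3 / 4 ≤ |W x - 1 - S x| := by
      have h1 := (abs_le.1 (hcW x hxle).1).2
      have h2 := hSpos x
      rw [abs_of_neg (by linarith)]
      linarith
    have hp0 : W x - 1 + S x ≠ 0 := abs_pos.1 (lt_of_lt_of_le (by positivity) hcpx)
    have hm0' : W x - 1 - S x ≠ 0 := abs_pos.1 (lt_of_lt_of_le (by norm_num) hcmx)
    have h := char_deriv_norm_le (hsol x hx) hp0 hm0'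
    rw [← hKx x, ← hdp x hx, ← hdm x hx] at h
    refine h.trans (mul_le_mul_of_nonneg_right ?_ (norm_nonneg _))
    have hKy : K x ≤ B₀ := by
      have h' := hB₀ x ⟨by linarith [neg_abs_le x], hxle⟩
      rw [Real.norm_eq_abs] at h'
      exact (le_abs_self _).trans h'
    have hi1 : |W x - 1 + S x|⁻¹ ≤ 8 / 3 / |x| := by
      rw [inv_le_comm₀ (abs_pos.2 hp0) (by positivity), inv_div]
      linarith
    have hi2 : |W x - 1 - S x|⁻¹ ≤ 4 / 3 / |x| := by
      rw [inv_le_comm₀ (abs_pos.2 hm0') (by positivity), inv_div]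
      have : |x| / (4 / 3) ≤ 3 / 4 := by rw [div_le_iff₀ (by norm_num)]; linarith
      linarith
    have hK0 : 0 ≤ K x := by rw [hKx x]; positivity
    calc K x * (|W x - 1 + S x|⁻¹ + |W x - 1 - S x|⁻¹) ≤ B₀ * (8 / 3 / |x| + 4 / 3 / |x|) :=
          mul_le_mul hKy (add_le_add hi1 hi2) (by positivity) hB₀0
      _ = 4 * B₀ / |x| := by field_simp; ring
  -- conclusion on every closed sub-interval `[−b, b] ⊂ I`
  intro x hx
  set b : ℝ := (|x| + δ) / 2 with hb
  have hxabs : |x| < δ := abs_lt.2 ⟨hx.1, hx.2⟩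
  have hb0 : 0 < b := by rw [hb]; positivity
  have hbδ : b < δ := by rw [hb]; linarith
  have hxb : |x| ≤ b := by rw [hb]; linarith
  have hsub : Icc (-b) b ⊆ I := fun y hy => ⟨by linarith [hy.1], by linarith [hy.2]⟩
  have hzero := eq_zero_of_jets_eq_zero_of_singular_bound (C := 4 * B₀) hb0 (by linarith) (by positivity) hIo hsub hpC hmC
    hjet (fun y hy hy0 hyb => hbound y hy hy0 (by linarith))
  obtain ⟨hpx, hmx⟩ := hzero x ⟨by linarith [neg_abs_le x], (le_abs_self x).trans hxb⟩
  constructor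
  · linear_combination (hpx + hmx) / 2
  · linear_combination (hpx - hmx) / 6

end Summit.AtomisticToContinuum.HydrodynamicLimit.Theorems.SonicCavityRenewal

end
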